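import Literature.AnabelianGeometry.EtaleTheta.FrobenioidMonoThetaThm510iSubProofs
import Literature.AnabelianGeometry.EtaleTheta.FrobenioidMonoThetaKummerExtension
import Literature.AnabelianGeometry.EtaleTheta.Discharge.Sec5OfModelData

/-!
# [EtTh] Lemma 5.8, arithmetic step: the "constants are fixed" HALF of `InvariantUnitsEqConstants` from the birational action (p. 331 / PDF p. 105)

Mochizuki, *The étale theta function …*, Publ. RIMS **45** (2009)
[cite: MochizukiEtTh2009, Lem 5.8 p.331 (PDF p.105)].  Seat abc-iut-L2-t4 (§5 owner), W3-L2-01, PROOF-ONLY.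

abc-iut-w4-d095's sub-DAG file `FrobenioidMonoThetaThm510iSub.lean` (K5) cuts the arithmetic step of Lemma 5.8
(`ThetaFrobenioid.ConstantsActByCyclotome`, abc-iut-L2-t4's named input) down to `InvariantUnitsEqConstants` — "the units of
`B_N` fixed by `Π^tp_Y` are EXACTLY the constant units" — and proves `ConstantsActByCyclotome ⟸ InvariantUnitsEqConstants`
(`FrobenioidMonoThetaThm510iSubProofs.lean`).  Of the two directions of that biconditional, ONE is structural: a constant unit is
fixed by every `Aut_C(B_N)`-conjugation, because "the natural inclusion `K^× ↪ O^×(B_N^birat)`" lands in the invariants of the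
natural action on `O^×(B_N^birat)` and `O^×(B_N) ↪ O^×(B_N^birat)` is equivariant and injective — i.e. it follows from the laws of
abc-iut-L2-t11's `BiratAutAction` (`act_constEmb`, `act_unitsToBirat`; INSTANTIATED for the assembled data by
`biratAutAction_ofModelData`, p418549).  This file proves that half in CONJUGATION form (`conj_eq_of_mem_constEmb_range`,
`invariantUnitsEqConstants_of_conjFixed`; abc-iut-w4-d095's sibling `invariantUnitsEqConstants_of_biratAutAction` of
`FrobenioidMonoThetaKummerExtension.lean` states the residual in birational form) and leaves as the SINGLE arithmetic input the converse `hgc` — "a unit of `B_N`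
fixed by `Π^tp_Y` is a constant" (print: "since `Y` is geometrically connected over `K`", p.331 (PDF p.105); [EtTh] Prop. 3.4 (ii)) —
whence `ConstantsActByCyclotome` (`constantsActByCyclotome_of_conjFixed`) and, for the §5 data assembled over the model setting,
the bundle `Facts` from {`hσ`, `hH`, `hconst`, `hgc`} (`facts_ofModelData_of_geomConnected`).
HONEST FRAMING: kernel-checked implications; `hgc` is a printed input stated as a binder; no side taken downstream.
-/

noncomputable section

namespace Literature.AnabelianGeometry.EtaleTheta

open CategoryTheory Opposite Literature.AlgebraicGeometry.Frobenioids

universe u₀ v₀ u v w w' v' u' u''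

namespace ThetaFrobenioid

section Generic

variable {C : Type u'} [Category.{v'} C] {D : Type u''} [Category.{w'} D] (𝔉 : ThetaFrobenioid.{w} C D)

/-- **A constant unit is fixed by every conjugation** (Lemma 5.8 proof, p.331 (PDF p.105)): if the image of `u ∈ O^×(B_N)` in
`O^×(B_N^birat)` is a constant, then `e ∘ u ∘ e⁻¹ = u` for every `e ∈ Aut_C(B_N)` — by the laws of the natural action on `O^×(B_N^birat)`
(constants fixed; `O^×(B_N) ↪ O^×(B_N^birat)` equivariant and injective).  [cite: MochizukiEtTh2009, Lem 5.8 p.331 (PDF p.105)] -/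
theorem conj_eq_of_mem_constEmb_range (α : 𝔉.BiratAutAction) (u : 𝔉.units 𝔉.BN) (hu : 𝔉.unitsToBirat 𝔉.BN u ∈ 𝔉.constEmb.range) (e : Aut 𝔉.BN) :
    e * (u : Aut 𝔉.BN) * e⁻¹ = u := by
  obtain ⟨k, hk⟩ := hu
  have h1 := α.act_unitsToBirat e u
  rw [← hk, α.act_constEmb, hk] at h1
  exact congrArg Subtype.val (𝔉.unitsToBirat_injective 𝔉.BN h1).symm

/-- **`InvariantUnitsEqConstants` from its arithmetic half**: given the natural action on `O^×(B_N^birat)` (`BiratAutAction`), the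
biconditional "`u ∈ O^×(B_N)` is `Π^tp_Y`-fixed ⟺ `u` is a constant" holds as soon as its forward direction `hgc` does ("since `Y`
is geometrically connected over `K`", Lemma 5.8 proof, p.331 (PDF p.105)); the backward direction is `conj_eq_of_mem_constEmb_range`.
[cite: MochizukiEtTh2009, Lem 5.8 p.331 (PDF p.105)] -/
theorem invariantUnitsEqConstants_of_conjFixed (α : 𝔉.BiratAutAction)
    (hgc : ∀ u : 𝔉.units 𝔉.BN, (∀ y ∈ 𝔉.imPiY, 𝔉.sgpCap y * (u : Aut 𝔉.BN) * (𝔉.sgpCap y)⁻¹ = u) →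
      𝔉.unitsToBirat 𝔉.BN u ∈ 𝔉.constEmb.range) :
    𝔉.InvariantUnitsEqConstants :=
  fun u => ⟨hgc u, fun hu y _ => 𝔉.conj_eq_of_mem_constEmb_range α u hu (𝔉.sgpCap y)⟩

/-- **Lemma 5.8's arithmetic step `ConstantsActByCyclotome` from the birational action and the geometric-connectedness input `hgc`**
(abc-iut-w4-d095's `constantsActByCyclotome_of_invariantUnitsEqConstants` composed with `invariantUnitsEqConstants_of_conjFixed`).
[cite: MochizukiEtTh2009, Lem 5.8 p.331 (PDF p.105)] -/
theorem constantsActByCyclotome_of_conjFixed (α : 𝔉.BiratAutAction)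
    (hgc : ∀ u : 𝔉.units 𝔉.BN, (∀ y ∈ 𝔉.imPiY, 𝔉.sgpCap y * (u : Aut 𝔉.BN) * (𝔉.sgpCap y)⁻¹ = u) →
      𝔉.unitsToBirat 𝔉.BN u ∈ 𝔉.constEmb.range) :
    𝔉.ConstantsActByCyclotome :=
  𝔉.constantsActByCyclotome_of_invariantUnitsEqConstants (𝔉.invariantUnitsEqConstants_of_conjFixed α hgc)

end Generic

/-! ### For the §5 data assembled over the model setting -/

section Model

variable {K : Type u₀} [Field K] {X : SemiGraphs.TemperedArithmeticGroup.{u₀} K} {D₀ : Type u₀} [Category.{v₀} D₀]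
  {V : FrdIMonoidStub.{w}} {T₀ : RealifiedDivisorMonoids (D₀ := D₀) V} {D : Type u} [Category.{v} D]
  {VD : FrdICatStub.{u, v, w} D} {tf : TemperedFrobenioid T₀ D VD} {hZ : tf.monoidType = MonoidType.Z}
  {hP : ∀ A : Dᵒᵖ, IsPerfect (tf.Φ.carrier A)} {hBΛ : ∀ (Y : D₀ᵒᵖ) (b : T₀.BΛ.obj Y), IsUnit b}
  {DS : ∀ {A : Dᵒᵖ}, tf.Φ.carrier A → tf.Φ.carrier A → Prop} {IG : D → Prop}
  {gS : ∀ A : D, IG A → (X.Pi →* Aut A)} {gSs : ∀ (A : D) (h : IG A), Function.Surjective (gS A h)}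
  {NH : Subgroup (Field.absoluteGaloisGroup K) → tf.category → ℕ+ → Prop}
  {AB : ∀ {A B : tf.category}, Subgroup (Aut A) → (A ⟶ A) → (A ⟶ B) → Prop} {A₀ : tf.category}
  {hA₀ : PreFrobenioid.IsFrobeniusTrivial tf.toElem A₀} {hA₀' : IG A₀.base}
  {pullFrac : ∀ {A A' : (BiKummerSetting.mkOfModel X tf hZ hP hBΛ DS IG gS gSs NH AB A₀ hA₀ hA₀').C} (_ : A' ⟶ A),
    (BiKummerSetting.mkOfModel X tf hZ hP hBΛ DS IG gS gSs NH AB A₀ hA₀ hA₀').biratUnits A →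
      (BiKummerSetting.mkOfModel X tf hZ hP hBΛ DS IG gS gSs NH AB A₀ hA₀ hA₀').biratUnits A'}
  {lv N : ℕ+} {T : ThetaEnvData.{max v w} N}
  {θ : (BiKummerSetting.mkOfModel X tf hZ hP hBΛ DS IG gS gSs NH AB A₀ hA₀ hA₀').biratUnits
    (BiKummerSetting.mkOfModel X tf hZ hP hBΛ DS IG gS gSs NH AB A₀ hA₀ hA₀').Aodot}
  {Bl : (BiKummerSetting.mkOfModel X tf hZ hP hBΛ DS IG gS gSs NH AB A₀ hA₀ hA₀').C}
  {Pl : (BiKummerSetting.mkOfModel X tf hZ hP hBΛ DS IG gS gSs NH AB A₀ hA₀ hA₀').FractionPair θ Bl}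
  {Rl : (BiKummerSetting.mkOfModel X tf hZ hP hBΛ DS IG gS gSs NH AB A₀ hA₀ hA₀').NthRoot θ Pl lv pullFrac}
  (h : ModelFrobenioid.Hypotheses tf.divisorMonoid tf.ratFnFunctor) (Q : FrobenioidTheta.ThetaSubquotientStub.{w} D)
  (odd_l : Odd (lv : ℕ))
  (R : (BiKummerSetting.mkOfModel X tf hZ hP hBΛ DS IG gS gSs NH AB A₀ hA₀ hA₀').NthRoot Rl.root Rl.pair N pullFrac)
  (ιX : T.PiX ≃ₜ* X.Pi)
  (hopen : IsOpen (((BiKummerSetting.mkOfModel X tf hZ hP hBΛ DS IG gS gSs NH AB A₀ hA₀ hA₀').galoisSurj R.AN.base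
    R.αData.isGalois).ker : Set X.Pi))
  (σ : Aut R.AN.base →* Aut R.AN) (K' : Type w) [Field K']
  (constEmb : K'ˣ →* (BiKummerSetting.mkOfModel X tf hZ hP hBΛ DS IG gS gSs NH AB A₀ hA₀ hA₀').tf.biratUnitsModel R.BN)
  (constEmb_injective : Function.Injective constEmb)
  (hdivc : ∀ g : Aut R.BN.base,
    ModelFrobenioid.div ((σ ((BiKummerSetting.NthRoot.baseIso
      (BiKummerSetting.mkOfModel X tf hZ hP hBΛ DS IG gS gSs NH AB A₀ hA₀ hA₀') R).conjAut.symm g)).hom ≫ R.pair.num) =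
      ModelFrobenioid.div R.pair.num)
  (hdivp : ∀ y : T.PiYdd,
    ModelFrobenioid.div ((σ ((BiKummerSetting.mkOfModel X tf hZ hP hBΛ DS IG gS gSs NH AB A₀ hA₀ hA₀').galoisSurj R.AN.base
      R.αData.isGalois (ιX y.1))).hom ≫ R.pair.den) = ModelFrobenioid.div R.pair.den)

/-- **Lemma 5.8's `ConstantsActByCyclotome` for the §5 data assembled over the MODEL setting** (`𝔉' = ofBiKummerData …` at
`mkOfModel`, dictionary = identity), from the constants-fixed law `hconst` (Def. 3.6 (iii)) — through `biratAutAction_ofModelData` — and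
the geometric-connectedness input `hgc` alone.  [cite: MochizukiEtTh2009, Lem 5.8 p.331 (PDF p.105)] -/
theorem constantsActByCyclotome_ofModelData
    (hconst : ∀ (e : Aut R.BN) (k : K'ˣ), tf.biratAutModel R.BN e (constEmb k) = constEmb k)
    {𝔉' : ThetaFrobenioid.{w} (BiKummerSetting.mkOfModel X tf hZ hP hBΛ DS IG gS gSs NH AB A₀ hA₀ hA₀').C D}
    (h𝔉' : 𝔉' = ofBiKummerData h (fun _ => MonoidHom.id _) Q odd_l R ιX hopen σ K' constEmb constEmb_injective hdivc hdivp)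
    (hgc : ∀ u : 𝔉'.units 𝔉'.BN, (∀ y ∈ 𝔉'.imPiY, 𝔉'.sgpCap y * (u : Aut 𝔉'.BN) * (𝔉'.sgpCap y)⁻¹ = u) →
      𝔉'.unitsToBirat 𝔉'.BN u ∈ 𝔉'.constEmb.range) :
    𝔉'.ConstantsActByCyclotome := by
  subst h𝔉'
  exact constantsActByCyclotome_of_conjFixed _
    (biratAutAction_ofModelData h Q odd_l R ιX hopen σ K' constEmb constEmb_injective hdivc hdivp hconst) hgc

/-- **The bundle `Facts` of §5 named inputs for the model-assembled data from {`hσ`, `hH`, `hconst`, `hgc`}** — i.e. with EVERY one of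
abc-iut-L2-t4's eight §5 named inputs a THEOREM, modulo the section property of `σ` ([FrdI] Prop. 5.6; a theorem for
`σ := strvOfBiKummerData`), `Π^tp_Ÿ ⊆ H_⊙` (p.322), the constants-fixed law (Def. 3.6 (iii)) and the geometric-connectedness input of
Lemma 5.8's proof (p.331).  [cite: MochizukiEtTh2009, §5 p.330–331 (PDF pp.104–105)] -/
theorem facts_ofModelData_of_geomConnected (hσ : ∀ g : Aut R.AN.base, ModelFrobenioid.baseMap (σ g).hom = g.hom)
    (hH : ∀ y : T.PiX, y ∈ T.PiYdd →
      ιX y ∈ (BiKummerSetting.mkOfModel X tf hZ hP hBΛ DS IG gS gSs NH AB A₀ hA₀ hA₀').Hodot)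
    (hconst : ∀ (e : Aut R.BN) (k : K'ˣ), tf.biratAutModel R.BN e (constEmb k) = constEmb k)
    {𝔉' : ThetaFrobenioid.{w} (BiKummerSetting.mkOfModel X tf hZ hP hBΛ DS IG gS gSs NH AB A₀ hA₀ hA₀').C D}
    (h𝔉' : 𝔉' = ofBiKummerData h (fun _ => MonoidHom.id _) Q odd_l R ιX hopen σ K' constEmb constEmb_injective hdivc hdivp)
    (hgc : ∀ u : 𝔉'.units 𝔉'.BN, (∀ y ∈ 𝔉'.imPiY, 𝔉'.sgpCap y * (u : Aut 𝔉'.BN) * (𝔉'.sgpCap y)⁻¹ = u) →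
      𝔉'.unitsToBirat 𝔉'.BN u ∈ 𝔉'.constEmb.range) :
    𝔉'.Facts := by
  subst h𝔉'
  exact facts_ofModelData h Q odd_l R ιX hopen σ K' constEmb constEmb_injective hdivc hdivp hσ hH
    (constantsActByCyclotome_ofModelData h Q odd_l R ιX hopen σ K' constEmb constEmb_injective hdivc hdivp hconst rfl hgc)

end Model

end ThetaFrobenioid

end Literature.AnabelianGeometry.EtaleTheta

end
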